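import Summits.BirchSwinnertonDyer.BirchSwinnertonDyer.Theorems.PrintCf2RubinValueTwoEllipticUnitsLocalTower
import Literature.NumberTheory.ComplexMultiplication.EllipticUnits.RubinTheta
import Literature.NumberTheory.ComplexMultiplication.EllipticUnits.DivisionPointsIndex
import HarnessLib

/-!
# de Shalit II.2.4 (ii) for the elliptic units in `𝒰_𝔓`: `σ_𝔠·e(𝔞) · e(𝔠)^{N𝔞} = σ_𝔞·e(𝔠) · e(𝔞)^{N𝔠}` — the `hrel` of
# `exists_twisting_μ_eq_forall_seriesFamily` for `β := ellipticUnitsLocal` (brick B5, relation input)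

Cell `bsd-print-cf2`, width seat `bsd-line-cf2c-w4` g10; `--supports` the banked S3a item stmt-BirchSwinnertonDyer-24721 (helper,
Theses-free). THEOREMS ONLY; CONDITIONAL on the published named facts `DeShalit1987.prop24_ii_galoisAction` (II.2.4 (ii)),
`prop24_iii_unit`, `prop25_i_normRelation` where stated (hypotheses, never asserted).

PRINT (de Shalit II.2.4 (ii), p. 44): "`Θ(v; L, 𝔞)^{σ_𝔠} = Θ(v; 𝔠⁻¹L, 𝔞) = Θ(v; L, 𝔞𝔠)·Θ(v; L, 𝔠)^{−N𝔞}`", whence the symmetric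
relation `Θ(1; 𝔤, 𝔞)^{σ_𝔠}·Θ(1; 𝔤, 𝔠)^{N𝔞} = Θ(1; 𝔤, 𝔞𝔠) = Θ(1; 𝔤, 𝔠)^{σ_𝔞}·Θ(1; 𝔤, 𝔞)^{N𝔠}` used in II.4.12 to make the measure
`μ` independent of the auxiliary ideal (the `hrel : σ c • β a * β c ^ Nm a = σ a • β c * β a ^ Nm c` of the tree's
`exists_twisting_μ_eq_forall_seriesFamily`).  THIS file:

* §1 ★ `deShalitTheta_one_eq_of_isLatticeReps` / `isThetaValueOne_unique` — **`Θ(1; 𝔤, 𝔞)` is well defined** (independent of the period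
  pairs of lattices `ι(𝔤)`, `𝔞⁻¹ι(𝔤)` and of the representatives: Rubin's `Θ_{E,𝔞} ∘ ξ` reading `rubinTheta_toPoint` + `image_toPoint_erase_eq`);
* §2 ★ `algClosureEmb_artin_mul_pow_eq` — the relation IN `K(𝔤)`: for `y_𝔞, y_𝔠 ∈ K(𝔤)` under `Θ(1; 𝔤, 𝔞)`, `Θ(1; 𝔤, 𝔠)`,
  `ι̂(σ_𝔠 y_𝔞)·ι̂(y_𝔠)^{N𝔞} = ι̂(σ_𝔞 y_𝔠)·ι̂(y_𝔞)^{N𝔠}` (both `= Θ(1; 𝔤, 𝔞𝔠)`; `N𝔞 = #(𝔞⁻¹ι(𝔤)/ι(𝔤))`, `card_eq_absNorm`), hence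
  `artin_mul_pow_eq` in `K(𝔤)`;
* §3 ★★ `hrel_ellipticUnitsLocal` — **the relation in `𝒰_𝔓`** for `β := ellipticUnitsLocal` and ANY `g_𝔞, g_𝔠 ∈ Gal(K̄/K(𝔪))` acting on
  every `K(𝔪v^{m+1})` as the Artin symbols of `𝔞`, `𝔠` (`κ_v`-action = Galois action, `coe_val_rayAction_smul_ofGlobal`; products
  termwise) — VERBATIM the `hrel` shape with `Nm := Ideal.absNorm`.

HONEST FRAMING: bookkeeping over published named facts; nothing here closes a crux; no summit statement is proved; BSD is not proved by any of this.

## References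
* [deShalit1987] E. de Shalit, *Iwasawa theory of elliptic curves with complex multiplication* (1987), II.2.3 (10), II.2.4 (ii) (p. 44–45),
  II.4.12 (p. 66–69), II.4.5 (p. 58).
* [Rubin1999] K. Rubin, LNM 1716 (1999), §7.4 (`Θ_{L,𝔞} = Θ_{E,𝔞} ∘ ξ`).
-/

-- the summit namespace `Summit.BirchSwinnertonDyer.BirchSwinnertonDyer` repeats the problem name by design (D-0017)
set_option linter.dupNamespace false
set_option autoImplicit false

noncomputable section

open scoped Classical nonZeroDivisors
open scoped NumberField
open Field IsDedekindDomain IsDedekindDomain.HeightOneSpectrum ValuativeRel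
open Literature.NumberTheory.NumberFields
open Literature.NumberTheory.GaloisRepresentations Literature.NumberTheory.GaloisRepresentations.IsNonarchimedeanLocalField
  Literature.NumberTheory.GaloisRepresentations.LubinTate Literature.NumberTheory.GaloisRepresentations.ArtinLocalGlobal
open Literature.NumberTheory.EllipticCurves
open Literature.NumberTheory.ComplexMultiplication.EllipticUnits
open Literature.NumberTheory.LFunctions.AbelianDensity (artinSymbol)
open Summit.BirchSwinnertonDyer.BirchSwinnertonDyer.Theorems.PrintCf2.LeopoldtAtV

namespace Summit.BirchSwinnertonDyer.BirchSwinnertonDyer.Theorems.PrintCf2.EllipticUnitsLocal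

variable {K : Type} [Field K] [NumberField K] {𝔪 : Ideal (𝓞 K)} {v : HeightOneSpectrum (𝓞 K)}

/-! ## §1. `Θ(1; 𝔤, 𝔞)` is well defined -/

omit [NumberField K] in
/-- **Independence of the representatives**: `Θ(z; L, L′, S) = Θ(z; L, L′, S′)` for two systems of representatives of `Λ′/Λ` and
`z ∉ Λ` (both are `Δ(L)/Δ(L′) · Θ_{E_Λ,·}(ξ(z))` over the canonical point set `ξ(S ∖ 0) = ξ(S′ ∖ 0)`). [cite: Rubin1999, §7.4 (chunks p0243–p0244)]
[cite: deShalit1987, II.2.3 (10)] -/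
theorem deShalitTheta_eq_of_isLatticeReps {L L' : PeriodPair} {S S' : Finset ℂ} (hS : L.IsLatticeReps L' S)
    (hS' : L.IsLatticeReps L' S') {z : ℂ} (hz : z ∉ L.lattice) : L.deShalitTheta L' S z = L.deShalitTheta L' S' z := by
  rw [PeriodPair.deShalitTheta_def, PeriodPair.deShalitTheta_def]
  congr 1
  have h1 := rubinTheta_toPoint hS 1 hz
  have h2 := rubinTheta_toPoint hS' 1 hz
  rw [image_toPoint_erase_eq hS hS', h2, one_pow, inv_one, one_mul, one_mul] at h1
  exact h1.symm

/-- Transport of a system of representatives along equalities of BOTH lattices. [cite: deShalit1987, II.2.3 (10)] -/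
private theorem isLatticeReps_of_lattice_eq₂ {L L₂ L' L₂' : PeriodPair} {S : Finset ℂ} (h : L.IsLatticeReps L' S)
    (e : L.lattice = L₂.lattice) (e' : L'.lattice = L₂'.lattice) : L₂.IsLatticeReps L₂' S :=
  ⟨fun x ↦ by rw [← e, ← e']; exact h.mem_iff x, h.zero_mem, fun c hc c' hc' hcc' ↦ h.distinct c hc c' hc' (by rwa [e])⟩

omit [NumberField K] in
/-- ★ **`Θ(1; 𝔤, 𝔞)` is well defined** (`𝔤 ≠ 𝒪_K`): two values of the predicate `IsThetaValueOne ι 𝔤 𝔞` coincide — the lattices `ι(𝔤)`,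
`𝔞⁻¹ι(𝔤)` are determined, `Θ` depends on the period pairs only through their lattices, and on the representatives not at all.
[cite: deShalit1987, II.2.3 (10), II.2.4] [cite: Kato2004Asterisque, §15.5 (p. 253)] -/
theorem isThetaValueOne_unique {ι : K →+* ℂ} {𝔤 𝔞 : Ideal (𝓞 K)} (h𝔤 : 𝔤 ≠ ⊤) {θ θ' : ℂ} (h : IsThetaValueOne ι 𝔤 𝔞 θ)
    (h' : IsThetaValueOne ι 𝔤 𝔞 θ') : θ = θ' := by
  obtain ⟨L, La, S, hL, hLa, hS, rfl⟩ := h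
  obtain ⟨L', La', S', hL', hLa', hS', rfl⟩ := h'
  have eL : L.lattice = L'.lattice := lattice_eq_of_mem_iff hL hL'
  have eLa : La.lattice = La'.lattice := by rw [hLa, hLa', eL]
  have h1 : (1 : ℂ) ∉ L'.lattice := fun h1 ↦ by
    obtain ⟨a, ha, h1a⟩ := (hL' 1).mp h1
    have ha1 : (a : K) = 1 := ι.injective (by rw [map_one]; exact h1a.symm)
    exact h𝔤 ((Ideal.eq_top_iff_one _).mpr (by rwa [show a = 1 from Subtype.ext ha1] at ha))
  rw [PeriodPair.deShalitTheta_eq_of_lattice_eq eL eLa S]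
  exact deShalitTheta_eq_of_isLatticeReps (isLatticeReps_of_lattice_eq₂ hS eL eLa) hS' h1

omit [NumberField K] in
/-- `Θ(1; 𝔤, 𝔞)` computed on any admissible data: `θ = Θ(1; L, La, S)`. [cite: deShalit1987, II.2.3 (10)] -/
theorem eq_deShalitTheta_of_isThetaValueOne {ι : K →+* ℂ} {𝔤 𝔞 : Ideal (𝓞 K)} (h𝔤 : 𝔤 ≠ ⊤) {θ : ℂ} (h : IsThetaValueOne ι 𝔤 𝔞 θ)
    {L La : PeriodPair} {S : Finset ℂ} (hL : ∀ z : ℂ, z ∈ L.lattice ↔ ∃ a ∈ 𝔤, z = ι (a : K))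
    (hLa : La.lattice = idealInvLattice ι 𝔞 L.lattice) (hS : L.IsLatticeReps La S) : θ = L.deShalitTheta La S 1 :=
  isThetaValueOne_unique h𝔤 h ⟨L, La, S, hL, hLa, hS, rfl⟩

/-! ## §2. de Shalit II.2.4 (ii) as a relation in `K(𝔤)` -/

/-- ★ **II.2.4 (ii) in `K(𝔤)`, symmetric form**: for `K` imaginary quadratic, `𝔤 ≠ 0, 𝒪_K`, non-zero `𝔞`, `𝔠` prime to `𝔤`, and
`y_𝔞, y_𝔠 ∈ K(𝔤)` with `ι̂ y_𝔞 = Θ(1; 𝔤, 𝔞)`, `ι̂ y_𝔠 = Θ(1; 𝔤, 𝔠)`: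
`ι̂(σ_𝔠 y_𝔞)·ι̂(y_𝔠)^{N𝔞} = Θ(1; 𝔤, 𝔞𝔠)` — GIVEN II.2.4 (ii) (`σ_𝔠 = (𝔠, K(𝔤)/K)` the tree's `artinSymbol (galFrob K K(𝔤)) 𝔠`).
[cite: deShalit1987, II.2.4 Proposition (ii)] -/
theorem isThetaValueOne_algClosureEmb_artin_mul_pow (h24ii : DeShalit1987.prop24_ii_galoisAction) (hK : IsImaginaryQuadratic K)
    (ι : K →+* ℂ) {𝔤 𝔞 𝔠 : Ideal (𝓞 K)} (h𝔤0 : 𝔤 ≠ ⊥) (h𝔤1 : 𝔤 ≠ ⊤) (h𝔞0 : 𝔞 ≠ ⊥) (h𝔞𝔤 : IsCoprime 𝔞 𝔤)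
    (h𝔠0 : 𝔠 ≠ ⊥) (h𝔠𝔤 : IsCoprime 𝔠 𝔤)
    {ya : rayClassField K 𝔤} (hya : IsThetaValueOne ι 𝔤 𝔞 (algClosureEmb ι (ya : AlgebraicClosure K)))
    {yc : rayClassField K 𝔤} (hyc : IsThetaValueOne ι 𝔤 𝔠 (algClosureEmb ι (yc : AlgebraicClosure K))) :
    IsThetaValueOne ι 𝔤 (𝔞 * 𝔠)
      (algClosureEmb ι ((artinSymbol (galFrob K (rayClassField K 𝔤)) 𝔠 ya : rayClassField K 𝔤) : AlgebraicClosure K) *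
        algClosureEmb ι (yc : AlgebraicClosure K) ^ Ideal.absNorm 𝔞) := by
  obtain ⟨L, La, S, hL, hLa, hS, hyaθ⟩ := hya
  have hLcm : IsCMLattice ι L.lattice := isCMLattice_of_mem_iff hL
  -- the `𝔠`-data over `L`
  obtain ⟨Lc, hLc⟩ := exists_periodPair_lattice_eq_idealInvLattice hLcm h𝔠0
  obtain ⟨T, hT⟩ := PeriodPair.IsLatticeReps.exists (L := L) (L' := Lc) (by rw [hLc]; exact le_idealInvLattice hLcm 𝔠)
  have hLccm : IsCMLattice ι Lc.lattice := by rw [hLc]; exact isCMLattice_idealInvLattice hLcm 𝔠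
  obtain ⟨Lca, hLca⟩ := exists_periodPair_lattice_eq_idealInvLattice hLccm h𝔞0
  obtain ⟨Sc, hSc⟩ := PeriodPair.IsLatticeReps.exists (L := Lc) (L' := Lca) (by rw [hLca]; exact le_idealInvLattice hLccm 𝔞)
  obtain ⟨Lac, hLac⟩ := exists_periodPair_lattice_eq_idealInvLattice hLcm (mul_ne_zero h𝔞0 h𝔠0)
  obtain ⟨U, hU⟩ := PeriodPair.IsLatticeReps.exists (L := L) (L' := Lac) (by rw [hLac]; exact le_idealInvLattice hLcm (𝔞 * 𝔠))
  obtain ⟨ha, hb⟩ := h24ii K hK ι L La Lc Lca Lac S Sc T U 𝔤 𝔞 𝔠 1 hLcm h𝔤0 h𝔤1 (isPrimitiveDivisionPoint_one_of_mem_iff hL)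
    h𝔞0 h𝔞𝔤 h𝔠0 h𝔠𝔤 hLa hS hLc hT hLca hSc hLac hU
  -- `ι̂ y_𝔠 = Θ(1; L, Lc, T)` (well-definedness) and `#S = N𝔞`
  have hycθ : algClosureEmb ι (yc : AlgebraicClosure K) = L.deShalitTheta Lc T 1 := eq_deShalitTheta_of_isThetaValueOne h𝔤1 hyc hL hLc hT
  rw [ha ya hyaθ, hycθ, ← hS.card_eq_absNorm hK ι hLcm h𝔞0 hLa, hb]
  exact ⟨L, Lac, U, hL, hLac, hU, rfl⟩

/-- ★ **THE SYMMETRIC RELATION in `K(𝔤)`**: `σ_𝔠 y_𝔞 · y_𝔠^{N𝔞} = σ_𝔞 y_𝔠 · y_𝔞^{N𝔠}` (both have `ι̂`-value `Θ(1; 𝔤, 𝔞𝔠)`; `ι̂` injective).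
[cite: deShalit1987, II.2.4 Proposition (ii), II.4.12 (p. 66)] -/
theorem artin_mul_pow_eq (h24ii : DeShalit1987.prop24_ii_galoisAction) (hK : IsImaginaryQuadratic K) (ι : K →+* ℂ)
    {𝔤 𝔞 𝔠 : Ideal (𝓞 K)} (h𝔤0 : 𝔤 ≠ ⊥) (h𝔤1 : 𝔤 ≠ ⊤) (h𝔞0 : 𝔞 ≠ ⊥) (h𝔞𝔤 : IsCoprime 𝔞 𝔤) (h𝔠0 : 𝔠 ≠ ⊥) (h𝔠𝔤 : IsCoprime 𝔠 𝔤)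
    {ya : rayClassField K 𝔤} (hya : IsThetaValueOne ι 𝔤 𝔞 (algClosureEmb ι (ya : AlgebraicClosure K)))
    {yc : rayClassField K 𝔤} (hyc : IsThetaValueOne ι 𝔤 𝔠 (algClosureEmb ι (yc : AlgebraicClosure K))) :
    ((artinSymbol (galFrob K (rayClassField K 𝔤)) 𝔠 ya : rayClassField K 𝔤) : AlgebraicClosure K) *
        (yc : AlgebraicClosure K) ^ Ideal.absNorm 𝔞 =
      ((artinSymbol (galFrob K (rayClassField K 𝔤)) 𝔞 yc : rayClassField K 𝔤) : AlgebraicClosure K) *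
        (ya : AlgebraicClosure K) ^ Ideal.absNorm 𝔠 := by
  apply (algClosureEmb ι).injective
  rw [map_mul, map_pow, map_mul, map_pow]
  have h1 := isThetaValueOne_algClosureEmb_artin_mul_pow h24ii hK ι h𝔤0 h𝔤1 h𝔞0 h𝔞𝔤 h𝔠0 h𝔠𝔤 hya hyc
  have h2 := isThetaValueOne_algClosureEmb_artin_mul_pow h24ii hK ι h𝔤0 h𝔤1 h𝔠0 h𝔠𝔤 h𝔞0 h𝔞𝔤 hyc hya
  rw [mul_comm 𝔠 𝔞] at h2
  exact isThetaValueOne_unique h𝔤1 h1 h2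

/-! ## §3. The Galois elements `g_𝔞`: one lift of `(𝔞, ·/K)` for all levels -/

/-- **A single `g_𝔞 ∈ Γ_K` restricting to `(𝔞, K(𝔪v^{m+1})/K)` at EVERY level** (`𝔞 ≠ 0` prime to `𝔪v`): a lift of the idelic Artin
symbol of `𝔞` (`exists_forall_absRestrictNormalHom_eq_artinHom`, `artinHom = artinSymbol` on integral ideals). Its membership in
`Gal(K̄/K(𝔪))` is the extra condition `(𝔞, K(𝔪)/K) = 1` (e.g. `𝔞 = (a)`, `a ≡ 1 mod 𝔪`: `exists_forall_absRestrictNormalHom_eq_artinHom_span_singleton`).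
[cite: NeukirchANT1999, Ch. VI §7 Thm. (7.1)] [cite: deShalit1987, II.4.12 (p. 66)] -/
theorem exists_forall_absRestrictNormalHom_eq_artinSymbol (h𝔪0 : 𝔪 ≠ ⊥) (v : HeightOneSpectrum (𝓞 K)) {𝔞 : Ideal (𝓞 K)}
    (h𝔞0 : 𝔞 ≠ ⊥) (h𝔞c : IsCoprime 𝔞 (𝔪 * v.asIdeal)) :
    ∃ g : absoluteGaloisGroup K, ∀ m : ℕ,
      absRestrictNormalHom (rayClassField K (𝔪 * v.asIdeal ^ (m + 1))) g =
        artinSymbol (galFrob K (rayClassField K (𝔪 * v.asIdeal ^ (m + 1)))) 𝔞 := by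
  obtain ⟨g, hg⟩ := exists_forall_absRestrictNormalHom_eq_artinHom (K := K)
    (Units.mk0 (𝔞 : FractionalIdeal (𝓞 K)⁰ K) (coeIdeal_ne_zero_of_ne_bot h𝔞0))
  refine ⟨g, fun m ↦ ?_⟩
  rw [hg _ (mul_pow_succ_ne_bot h𝔪0 v m)
    (unitsMk0_coeIdeal_mem_idealsPrimeTo (mul_pow_succ_ne_bot h𝔪0 v m) h𝔞0 (isCoprime_mul_pow_succ h𝔞c m)),
    artinHom_unitsMk0_coeIdeal _ h𝔞0]

/-! ## §4. The relation in `𝒰_𝔓` — the `hrel` of `exists_twisting_μ_eq_forall_seriesFamily` for `β := ellipticUnitsLocal` -/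

section ValLemmas

attribute [local instance] ltNormUniformSpace ltNormIsUniformAddGroup rk1 nF nE fintypeResidueField
attribute [local instance] RelNormCoherentUnits.instCommMonoid

omit [NumberField K] in
/-- Components of powers in the monoid `𝒰_𝔓`: `(β^n)_m = (β_m)^n`. [cite: deShalit1987, I.2.3 (i) (p. 14)] -/
theorem _root_.Literature.NumberTheory.GaloisRepresentations.RelNormCoherentUnits.val_pow
    {F : Type} [Field F] [ValuativeRel F] [TopologicalSpace F] [IsNonarchimedeanLocalField F]
    {π' : 𝒪[F]} {hπ' : (valuation F).IsUniformizer (π' : F)} {E' : IntermediateField F (AlgebraicClosure F)} [FiniteDimensional F E']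
    (β : RelNormCoherentUnits hπ' E') (n m : ℕ) : (β ^ n).val m = β.val m ^ n := by
  induction n with
  | zero => rw [pow_zero, pow_zero]; rfl
  | succ n ih => rw [pow_succ, pow_succ, ← ih]; rfl

omit [NumberField K] in
/-- Components of products in the monoid `𝒰_𝔓`: `(ββ′)_m = β_m β′_m`. [cite: deShalit1987, I.2.3 (i) (p. 14)] -/
theorem _root_.Literature.NumberTheory.GaloisRepresentations.RelNormCoherentUnits.val_mul'
    {F : Type} [Field F] [ValuativeRel F] [TopologicalSpace F] [IsNonarchimedeanLocalField F]
    {π' : 𝒪[F]} {hπ' : (valuation F).IsUniformizer (π' : F)} {E' : IntermediateField F (AlgebraicClosure F)} [FiniteDimensional F E']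
    (β β' : RelNormCoherentUnits hπ' E') (m : ℕ) : (β * β').val m = β.val m * β'.val m := rfl

end ValLemmas

section Local

attribute [local instance] RelNormCoherentUnits.instCommMonoid

variable [NumberField.IsTotallyComplex K]
  (h24ii : DeShalit1987.prop24_ii_galoisAction) (h24iii : DeShalit1987.prop24_iii_unit) (h25 : DeShalit1987.prop25_i_normRelation)
  (hK : IsImaginaryQuadratic K) (ι : K →+* ℂ)
  (h𝔪0 : 𝔪 ≠ ⊥) (h𝔪1 : 𝔪 ≠ ⊤) (hv : ¬ 𝔪 ≤ v.asIdeal) (hw : ∀ u : (𝓞 K)ˣ, (u : 𝓞 K) - 1 ∈ 𝔪 → u = 1)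
  {π : 𝒪[v.adicCompletion K]} (hπ : (valuation (v.adicCompletion K)).IsUniformizer (π : v.adicCompletion K))
  {α : 𝓞 K} (hα0 : α ≠ 0) (hα𝔪 : α - 1 ∈ 𝔪) (hαw : ∀ w : HeightOneSpectrum (𝓞 K), w ≠ v → α ∉ w.asIdeal)
  {f : ℕ} (hαπ : ((α : K) : v.adicCompletion K) = (π : v.adicCompletion K) ^ f)
  (E : IntermediateField (v.adicCompletion K) (AlgebraicClosure (v.adicCompletion K)))
  [FiniteDimensional (v.adicCompletion K) E] [IsGalois (v.adicCompletion K) E] (hE : E ≤ maxUnramified (v.adicCompletion K))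
  (hdegE : ∀ w : WeilGroup (v.adicCompletion K),
    WeilGroup.toAbsGalois (v.adicCompletion K) w ∈ E.fixingSubgroup → (f : ℤ) ∣ WeilGroup.deg w)

include h24ii in
/-- ★★ **THE `hrel` OF THE ELLIPTIC UNITS IN `𝒰_𝔓`** (de Shalit II.2.4 (ii) transported through `RelNormCoherentUnits.ofGlobal`): for
non-zero `𝔞`, `𝔠` prime to `𝔪v`, families `x^𝔞`, `x^𝔠` under the theta values, and ANY `g_𝔞, g_𝔠 ∈ Gal(K̄/K(𝔪))` acting on every `K(𝔪v^{m+1})`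
as the Artin symbols `(𝔞, K(𝔪v^{m+1})/K)`, `(𝔠, K(𝔪v^{m+1})/K)`:
`g_𝔠 • e(𝔞) · e(𝔠)^{N𝔞} = g_𝔞 • e(𝔠) · e(𝔞)^{N𝔠}` in the monoid `𝒰_𝔓` with the `κ_v`-action — VERBATIM the shape
`σ c • β a * β c ^ Nm a = σ a • β c * β a ^ Nm c` of `exists_twisting_μ_eq_forall_seriesFamily`, `Nm := Ideal.absNorm`.
[cite: deShalit1987, II.2.4 Proposition (ii), II.4.12 (p. 66–69), II.4.5 (13) (p. 58)] -/
theorem hrel_ellipticUnitsLocal {𝔞 𝔠 : Ideal (𝓞 K)} (h𝔞0 : 𝔞 ≠ ⊥) (h𝔞c : IsCoprime 𝔞 (𝔪 * v.asIdeal))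
    (h𝔠0 : 𝔠 ≠ ⊥) (h𝔠c : IsCoprime 𝔠 (𝔪 * v.asIdeal))
    (xa : ∀ m : ℕ, rayClassField K (𝔪 * v.asIdeal ^ (m + 1)))
    (hxa : ∀ m, IsThetaValueOne ι (𝔪 * v.asIdeal ^ (m + 1)) 𝔞
      (algClosureEmb ι ((xa m : rayClassField K (𝔪 * v.asIdeal ^ (m + 1))) : AlgebraicClosure K)))
    (xc : ∀ m : ℕ, rayClassField K (𝔪 * v.asIdeal ^ (m + 1)))
    (hxc : ∀ m, IsThetaValueOne ι (𝔪 * v.asIdeal ^ (m + 1)) 𝔠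
      (algClosureEmb ι ((xc m : rayClassField K (𝔪 * v.asIdeal ^ (m + 1))) : AlgebraicClosure K)))
    (ga gc : ↥(absRestrictNormalHom (rayClassField K 𝔪)).ker)
    (hga : ∀ m : ℕ, absRestrictNormalHom (rayClassField K (𝔪 * v.asIdeal ^ (m + 1))) (ga : absoluteGaloisGroup K) =
      artinSymbol (galFrob K (rayClassField K (𝔪 * v.asIdeal ^ (m + 1)))) 𝔞)
    (hgc : ∀ m : ℕ, absRestrictNormalHom (rayClassField K (𝔪 * v.asIdeal ^ (m + 1))) (gc : absoluteGaloisGroup K) =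
      artinSymbol (galFrob K (rayClassField K (𝔪 * v.asIdeal ^ (m + 1)))) 𝔠) :
    letI := rayAction h𝔪0 hv hw hπ E hE
    gc • ellipticUnitsLocal h24iii h25 hK ι h𝔪0 h𝔪1 hv hw hπ hα0 hα𝔪 hαw hαπ E hE hdegE h𝔞0 h𝔞c xa hxa *
        ellipticUnitsLocal h24iii h25 hK ι h𝔪0 h𝔪1 hv hw hπ hα0 hα𝔪 hαw hαπ E hE hdegE h𝔠0 h𝔠c xc hxc ^ Ideal.absNorm 𝔞 =
      ga • ellipticUnitsLocal h24iii h25 hK ι h𝔪0 h𝔪1 hv hw hπ hα0 hα𝔪 hαw hαπ E hE hdegE h𝔠0 h𝔠c xc hxc *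
        ellipticUnitsLocal h24iii h25 hK ι h𝔪0 h𝔪1 hv hw hπ hα0 hα𝔪 hαw hαπ E hE hdegE h𝔞0 h𝔞c xa hxa ^ Ideal.absNorm 𝔠 := by
  letI := rayAction h𝔪0 hv hw hπ E hE
  refine RelNormCoherentUnits.ext fun m ↦ Subtype.ext (Subtype.ext ?_)
  -- componentwise, in `K̄_v`
  rw [RelNormCoherentUnits.val_mul', RelNormCoherentUnits.val_mul', RelNormCoherentUnits.val_pow, RelNormCoherentUnits.val_pow,
    MulMemClass.coe_mul, MulMemClass.coe_mul, MulMemClass.coe_mul, MulMemClass.coe_mul, SubmonoidClass.coe_pow,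
    SubmonoidClass.coe_pow, SubmonoidClass.coe_pow, SubmonoidClass.coe_pow]
  unfold ellipticUnitsLocal
  rw [coe_val_rayAction_smul_ofGlobal, coe_val_rayAction_smul_ofGlobal, coe_val_ofGlobal, coe_val_ofGlobal, hga m, hgc m,
    ← map_pow, ← map_pow, ← map_mul, ← map_mul]
  congr 1
  exact artin_mul_pow_eq h24ii hK ι (mul_pow_succ_ne_bot h𝔪0 v m) (mul_pow_succ_ne_top 𝔪 v m) h𝔞0 (isCoprime_mul_pow_succ h𝔞c m)
    h𝔠0 (isCoprime_mul_pow_succ h𝔠c m) (hxa m) (hxc m)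

end Local

end Summit.BirchSwinnertonDyer.BirchSwinnertonDyer.Theorems.PrintCf2.EllipticUnitsLocal

end
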